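import Mathlib
import HarnessLib
import Summits.NavierStokesRegularity.NavierStokesRegularity.Theorems.TaylorModelRungThreeCertificateFormatV
import Summits.NavierStokesRegularity.NavierStokesRegularity.Theorems.TaylorModelRungThreeCertificateFormatVNode

/-!
# Crux K1b-DR (stmt-NavierStokesRegularity-23954), line `taylor-model` — v3 checker: the CROSS-STEP TRANSPORTS of the
# frame-absorbed vector step (`Vc`, `e`, `rp`, `Z`), their Boolean tests, and the coordinate-level SOUNDNESS
# (PROPAGATE-V-SPEC-cert1 rev. bcee1edc560e3a8a §2 E; `TaylorModelV.ChainVRadii` (R2)/(R4)/(R5); successor engine-1 g67)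

Given the node state `N` (`…FormatVNode.NodeSt`), the one-step derivative enclosure `M = [M_s]` over the outer hull
(produced by the jet side, clause (M) of `ChainVCore`), the stage box radii `rB` and the fresh centre-error bound `ν`, the
checker

* CHOOSES the next point data (`chosenVcB`): the emitted `(Vc, B)` at a chunk start (`some E : Option NodeV`), else
  `Vc' := rnd(mid[M]·Vc)` and `B' := frameB(rnd(mid[M]·B))`;
* COMPUTES (`radCompute`) `T := Ci'·([M]·B)`, `Dm := [M]·Vc ⊖ Vc'`, and the three transported objects
  `rpL := |T|·rp + |Ci'|·ν`, `eL := |Dm|·rB + |[M]|·e`, `ZL := Ci'·Dm + T·Z` (all outward / upward rounded);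
* forms the next node state (`stepNext`): emitted `(e, rp, Z)` at a chunk start, else `(eL, rpL, ZL)`, and TESTS
  `rpL ≤ rp'`, `eL ≤ e'`, `ZL ⊆ Z'` (trivially true inside a chunk, the containment test of §2 E at a chunk start — one
  code path, one soundness proof).

SOUNDNESS at the coordinate level (`stepNext_sound`), for every real `a ∈ [M]` and the true inverse `g ∈ Ci'` of the next
frame (supplied by `exists_inv_of_nodeOK` at node `s+1`): (R2c) `|g·(a·(B ξ) + r)| ≤ rp'` for `|ξ| ≤ rp`, `|r| ≤ ν`;
(R4c) `|a·(Vc ζ + d) − Vc' ζ| ≤ e'` for `|ζ| ≤ rB`, `|d| ≤ e`; (R5c) `g·(a·Vc − Vc') + (g·a·B)·w ∈ Z'` for every `w ∈ Z` —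
exactly the shapes that `…FormatVBridge.linF` turns into the semantic clauses of `ChainVRadii`. The triple/double sum
rearrangements are isolated in `sum3_swap`, `sum2_split`.
MODEL-lattice bookkeeping only (rung TL-M3, one finite-dimensional model ODE); nothing here concerns the Navier–Stokes equations.
-/

-- the sub-problem namespace repeats the summit name by design (D-0017)
set_option linter.dupNamespace false

namespace Summit.NavierStokesRegularity.NavierStokesRegularity.Theorems.TaylorModelCert

open scoped BigOperators

/-! ### The transports and their tests -/

section Defs

/-- The next node's point data `(Vc', B')`: emitted at a chunk start, else the rounded product / MGS frame (chosen).
[folklore] -/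
def chosenVcB (n precV precB : ℕ) (N : NodeSt) (M : Array (Array IntervalD)) (E : Option NodeV) :
    Array (Array Dyad) × Array (Array Dyad) :=
  match E with
  | some Ev => (Ev.Vc, Ev.B)
  | none => (mulDDr n precV (midM n M) N.Vc, frameB n precB (mulDDr n precB (midM n M) N.B))

/-- Output of the transport computation of one sub-step. [folklore] -/
structure RadOut where
  /-- `T = Ci'·([M]·B)` -/
  T : Array (Array IntervalD)
  /-- `Dm = [M]·Vc ⊖ Vc'` -/
  Dm : Array (Array IntervalD)
  /-- `rpL = |T|·rp + |Ci'|·ν` -/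
  rpL : Array Dyad
  /-- `eL = |Dm|·rB + |[M]|·e` -/
  eL : Array Dyad
  /-- `ZL = Ci'·Dm + T·Z` -/
  ZL : Array (Array IntervalD)

/-- **The transports** of one sub-step (PROPAGATE-V-SPEC §2 E). [folklore] -/
def radCompute (n prec : ℕ) (N : NodeSt) (Vc' : Array (Array Dyad)) (Ci' : Array (Array IntervalD))
    (M : Array (Array IntervalD)) (rB ν : Array Dyad) : RadOut :=
  let T := mulII n prec Ci' (mulID n prec M N.B)
  let Dm := subIMD n prec (mulID n prec M N.Vc) Vc'
  { T := T, Dm := Dm,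
    rpL := addVecUp n prec (absMulVecUp n prec (magM n T) N.rp) (absMulVecUp n prec (magM n Ci') ν),
    eL := addVecUp n prec (absMulVecUp n prec (magM n Dm) rB) (absMulVecUp n prec (magM n M) N.e),
    ZL := addIM n prec (mulII n prec Ci' Dm) (mulII n prec T N.Z) }

/-- **One cross-step**: the next node state and the Boolean of the three cross-step tests. [folklore] -/
def stepNext (n prec precV precB : ℕ) (N : NodeSt) (M : Array (Array IntervalD)) (rB ν : Array Dyad)
    (E : Option NodeV) : NodeSt × Bool :=
  let VB := chosenVcB n precV precB N M E
  let N₀ := mkNode n prec precB VB.1 #[] VB.2 #[] #[]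
  let R := radCompute n prec N VB.1 N₀.Ci M rB ν
  let next : NodeSt :=
    match E with
    | some Ev => { N₀ with e := Ev.e, rp := Ev.rp, Z := Ev.Z }
    | none => { N₀ with e := R.eL, rp := R.rpL, Z := R.ZL }
  (next, leVec n R.rpL next.rp && leVec n R.eL next.e && subsetIM n R.ZL next.Z)

end Defs

/-! ### Sum rearrangements -/

section Sums

variable (n : ℕ)

/-- `Σ_t f t·(Σ_u g t u·(Σ_v k u v·ξ v)) = Σ_v (Σ_t f t·(Σ_u g t u·k u v))·ξ v`. [folklore] -/
theorem sum3_swap (f : ℕ → ℝ) (g k : ℕ → ℕ → ℝ) (ξ : ℕ → ℝ) :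
    ∑ t ∈ Finset.range n, f t * ∑ u ∈ Finset.range n, g t u * ∑ v ∈ Finset.range n, k u v * ξ v =
      ∑ v ∈ Finset.range n, (∑ t ∈ Finset.range n, f t * ∑ u ∈ Finset.range n, g t u * k u v) * ξ v := by
  calc ∑ t ∈ Finset.range n, f t * ∑ u ∈ Finset.range n, g t u * ∑ v ∈ Finset.range n, k u v * ξ v
      = ∑ t ∈ Finset.range n, ∑ u ∈ Finset.range n, ∑ v ∈ Finset.range n, f t * (g t u * (k u v * ξ v)) := by
        simp only [Finset.mul_sum]
    _ = ∑ t ∈ Finset.range n, ∑ v ∈ Finset.range n, ∑ u ∈ Finset.range n, f t * (g t u * (k u v * ξ v)) :=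
        Finset.sum_congr rfl fun _ _ => Finset.sum_comm
    _ = ∑ v ∈ Finset.range n, ∑ t ∈ Finset.range n, ∑ u ∈ Finset.range n, f t * (g t u * (k u v * ξ v)) :=
        Finset.sum_comm
    _ = ∑ v ∈ Finset.range n, (∑ t ∈ Finset.range n, f t * ∑ u ∈ Finset.range n, g t u * k u v) * ξ v := by
        simp only [Finset.mul_sum, Finset.sum_mul]
        exact Finset.sum_congr rfl fun v _ => Finset.sum_congr rfl fun t _ => Finset.sum_congr rfl fun u _ => by ring

/-- `Σ_u a u·(Σ_v k u v·ζ v + d u) − Σ_v c v·ζ v = Σ_v (Σ_u a u·k u v − c v)·ζ v + Σ_u a u·d u`. [folklore] -/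
theorem sum2_split (a d c ζ : ℕ → ℝ) (k : ℕ → ℕ → ℝ) :
    ∑ u ∈ Finset.range n, a u * (∑ v ∈ Finset.range n, k u v * ζ v + d u) - ∑ v ∈ Finset.range n, c v * ζ v =
      ∑ v ∈ Finset.range n, (∑ u ∈ Finset.range n, a u * k u v - c v) * ζ v + ∑ u ∈ Finset.range n, a u * d u := by
  simp only [mul_add, Finset.sum_add_distrib, sub_mul, Finset.sum_sub_distrib, Finset.mul_sum, Finset.sum_mul]
  rw [Finset.sum_comm]
  have e : ∀ u ∈ Finset.range n, ∀ v ∈ Finset.range n, a u * (k u v * ζ v) = a u * k u v * ζ v :=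
    fun u _ v _ => by ring
  rw [Finset.sum_congr rfl fun v hv => Finset.sum_congr rfl fun u hu => (e u hu v hv)]
  ring

end Sums

/-! ### Soundness of the transports -/

section Sound

variable {n : ℕ} (prec : ℕ) {N : NodeSt} {Vc' : Array (Array Dyad)} {Ci' M : Array (Array IntervalD)}
  {rB ν : Array Dyad} {g a : ℕ → ℕ → ℝ}

/-- (R2c) **centre radii absorption**: `|g·(a·(B ξ) + r)| ≤ rpL`. [folklore] -/
theorem abs_rp_transport_le (hg : MemMat n g Ci') (ha : MemMat n a M) {ξ r : ℕ → ℝ} (hξ : AbsLeVec n ξ N.rp)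
    (hr : AbsLeVec n r ν) {i : ℕ} (hi : i < n) :
    |∑ t ∈ Finset.range n, g i t *
        (∑ u ∈ Finset.range n, a t u * ∑ v ∈ Finset.range n, dre N.B u v * ξ v + r t)| ≤
      vre (radCompute n prec N Vc' Ci' M rB ν).rpL i := by
  have hT : MemMat n (fun i v => ∑ t ∈ Finset.range n, g i t * ∑ u ∈ Finset.range n, a t u * dre N.B u v)
      (mulII n prec Ci' (mulID n prec M N.B)) := memMat_mulII prec hg (memMat_mulID prec ha N.B)
  have e : ∑ t ∈ Finset.range n, g i t * (∑ u ∈ Finset.range n, a t u * ∑ v ∈ Finset.range n, dre N.B u v * ξ v + r t) =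
      ∑ v ∈ Finset.range n, (∑ t ∈ Finset.range n, g i t * ∑ u ∈ Finset.range n, a t u * dre N.B u v) * ξ v +
        ∑ t ∈ Finset.range n, g i t * r t := by
    simp only [mul_add, Finset.sum_add_distrib, sum3_swap n]
  rw [e]
  refine (abs_add_le _ _).trans ?_
  refine le_trans (add_le_add (abs_sum_le_absMulVecUp prec (absLeMat_magM hT) hξ hi)
    (abs_sum_le_absMulVecUp prec (absLeMat_magM hg) hr hi)) ?_
  exact add_le_addVecUp prec _ _ hi

/-- (R4c) **plain set-error update**: `|a·(Vc ζ + d) − Vc' ζ| ≤ eL`. [folklore] -/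
theorem abs_e_transport_le (ha : MemMat n a M) {ζ d : ℕ → ℝ} (hζ : AbsLeVec n ζ rB) (hd : AbsLeVec n d N.e)
    (Ci' : Array (Array IntervalD)) (ν : Array Dyad) {i : ℕ} (hi : i < n) :
    |∑ u ∈ Finset.range n, a i u * (∑ v ∈ Finset.range n, dre N.Vc u v * ζ v + d u) -
        ∑ v ∈ Finset.range n, dre Vc' i v * ζ v| ≤
      vre (radCompute n prec N Vc' Ci' M rB ν).eL i := by
  have hDm : MemMat n (fun i v => (∑ u ∈ Finset.range n, a i u * dre N.Vc u v) - dre Vc' i v)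
      (subIMD n prec (mulID n prec M N.Vc) Vc') := memMat_subIMD prec (memMat_mulID prec ha N.Vc) Vc'
  rw [sum2_split n]
  refine (abs_add_le _ _).trans ?_
  refine le_trans (add_le_add (abs_sum_le_absMulVecUp prec (absLeMat_magM hDm) hζ hi)
    (abs_sum_le_absMulVecUp prec (absLeMat_magM ha) hd hi)) ?_
  exact add_le_addVecUp prec _ _ hi

/-- (R5c) **derivative-error transport**: `g·(a·Vc − Vc') + (g·a·B)·w ∈ ZL` for `w ∈ Z`. [folklore] -/
theorem memMat_Z_transport (hg : MemMat n g Ci') (ha : MemMat n a M) {w : ℕ → ℕ → ℝ} (hw : MemMat n w N.Z)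
    (rB ν : Array Dyad) :
    MemMat n (fun i c =>
        (∑ t ∈ Finset.range n, g i t * ((∑ u ∈ Finset.range n, a t u * dre N.Vc u c) - dre Vc' t c)) +
          ∑ v ∈ Finset.range n, (∑ t ∈ Finset.range n, g i t * ∑ u ∈ Finset.range n, a t u * dre N.B u v) * w v c)
      (radCompute n prec N Vc' Ci' M rB ν).ZL := by
  have hDm : MemMat n (fun i v => (∑ u ∈ Finset.range n, a i u * dre N.Vc u v) - dre Vc' i v)
      (subIMD n prec (mulID n prec M N.Vc) Vc') := memMat_subIMD prec (memMat_mulID prec ha N.Vc) Vc'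
  have hT : MemMat n (fun i v => ∑ t ∈ Finset.range n, g i t * ∑ u ∈ Finset.range n, a t u * dre N.B u v)
      (mulII n prec Ci' (mulID n prec M N.B)) := memMat_mulII prec hg (memMat_mulID prec ha N.B)
  exact memMat_addIM prec (memMat_mulII prec hg hDm) (memMat_mulII prec hT hw)

/-- The next node's `Vc`, `B`, `Ci` are those the transports were computed with; the test bounds them. [folklore] -/
theorem stepNext_sound {precV precB : ℕ} {E : Option NodeV}
    (h : (stepNext n prec precV precB N M rB ν E).2 = true)
    (hg : MemMat n g (stepNext n prec precV precB N M rB ν E).1.Ci) (ha : MemMat n a M) :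
    (∀ {ξ r : ℕ → ℝ}, AbsLeVec n ξ N.rp → AbsLeVec n r ν → ∀ i < n,
      |∑ t ∈ Finset.range n, g i t *
          (∑ u ∈ Finset.range n, a t u * ∑ v ∈ Finset.range n, dre N.B u v * ξ v + r t)| ≤
        vre (stepNext n prec precV precB N M rB ν E).1.rp i) ∧
    (∀ {ζ d : ℕ → ℝ}, AbsLeVec n ζ rB → AbsLeVec n d N.e → ∀ i < n,
      |∑ u ∈ Finset.range n, a i u * (∑ v ∈ Finset.range n, dre N.Vc u v * ζ v + d u) -
          ∑ v ∈ Finset.range n, dre (stepNext n prec precV precB N M rB ν E).1.Vc i v * ζ v| ≤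
        vre (stepNext n prec precV precB N M rB ν E).1.e i) ∧
    (∀ {w : ℕ → ℕ → ℝ}, MemMat n w N.Z →
      MemMat n (fun i c =>
          (∑ t ∈ Finset.range n, g i t *
              ((∑ u ∈ Finset.range n, a t u * dre N.Vc u c) - dre (stepNext n prec precV precB N M rB ν E).1.Vc t c)) +
            ∑ v ∈ Finset.range n, (∑ t ∈ Finset.range n, g i t * ∑ u ∈ Finset.range n, a t u * dre N.B u v) * w v c)
        (stepNext n prec precV precB N M rB ν E).1.Z) := by
  cases E with
  | none =>
    simp only [stepNext, chosenVcB, Bool.and_eq_true] at h hg ⊢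
    obtain ⟨⟨h1, h2⟩, h3⟩ := h
    refine ⟨fun hξ hr i hi => ?_, fun hζ hd i hi => ?_, fun hw => ?_⟩
    · exact (abs_rp_transport_le prec hg ha hξ hr hi).trans (le_of_leVec h1 hi)
    · exact (abs_e_transport_le prec ha hζ hd _ _ hi).trans (le_of_leVec h2 hi)
    · exact memMat_of_subsetIM h3 (memMat_Z_transport prec hg ha hw _ _)
  | some Ev =>
    simp only [stepNext, chosenVcB, Bool.and_eq_true] at h hg ⊢
    obtain ⟨⟨h1, h2⟩, h3⟩ := h
    refine ⟨fun hξ hr i hi => ?_, fun hζ hd i hi => ?_, fun hw => ?_⟩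
    · exact (abs_rp_transport_le prec hg ha hξ hr hi).trans (le_of_leVec h1 hi)
    · exact (abs_e_transport_le prec ha hζ hd _ _ hi).trans (le_of_leVec h2 hi)
    · exact memMat_of_subsetIM h3 (memMat_Z_transport prec hg ha hw _ _)

end Sound

end Summit.NavierStokesRegularity.NavierStokesRegularity.Theorems.TaylorModelCert
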